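import Mathlib
import Literature.Geometry.Lorentzian.Stationary
import Literature.Geometry.Lorentzian.Einstein
import Literature.Geometry.Lorentzian.Geodesic
import Literature.Geometry.Lorentzian.Causality
import Literature.Geometry.Lorentzian.IPlusRegular

/-!
# Sketch — crux idea `azimuthal-partial-analyticity` for crux stmt-FinalStateConjecture-13896
(`NonTrappingHawkingRigidity`), ideator k = 1, round 1.

First lemmas of the line, stated over existing declarations (elaboration only; no proofs claimed).

* `TwoKillingNonNullContinuation` — the Tataru–Robbiano–Zuily–Hörmander unique continuation theorem
  for operators with coefficients analytic in a group of variables, specialised to the wave operator of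
  a metric carrying TWO commuting Killing fields `T = 𝓑.killing` and `Z` whose span contains a timelike
  vector at `x₀`: in flow-box coordinates `(t, φ, x², x³)` the coefficients are independent of (hence
  analytic in) `(t, φ)`, the residual set `{ξ : ξ(T) = ξ(Z) = 0, g⁻¹(ξ,ξ) = 0}` is `{0}` (the annihilator of
  a timelike 2-plane is spacelike), so strong pseudo-convexity "in `ξ_t = ξ_φ = 0`" is EMPTY and unique
  continuation holds across EVERY non-null `C²` hypersurface through `x₀`, for arbitrary (not
  necessarily invariant) solutions `u` of `□_g u = 0`.  [Tataru, CPDE 20 (1995) 855–884; Tataru, JMPA 78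
  (1999) 505–521, Thm 1; Robbiano–Zuily, Invent. Math. 131 (1998) 493–539, Thm A; Hörmander, Cortona
  1996 (Birkhäuser PNLDE 32, 1997) 179–219; Laurent–Léautaud, *Lectures on unique continuation for
  waves* (hal-04151529) Thm 3.1, Def. 3.5, Lemma 3.6.]

* `NoEternalCompactWavesWithTwoKillingFields` — corollary (the LINEAR RUNG of the line, "no linear
  hair on axisymmetric backgrounds, trapping or not"): with `Z` Killing on the whole d.o.c., timelike
  Killing combinations at every point of the d.o.c., and a `(T,Z)`-invariant height `f` without critical
  points, every smooth solution of `□_g u = 0` on the d.o.c. vanishing off the `T`-orbit of a compact set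
  vanishes identically (take a point of the support maximising `f`; `df` annihilates the timelike plane,
  so the level set is timelike, hence non-characteristic; apply the previous statement).
-/

open scoped Manifold ContDiff Topology
open Set

namespace Summit.FinalStateConjecture.FinalStateConjecture.Cruxes.NonTrappingHawkingRigidity.AzimuthalPartialAnalyticity

open Literature.Geometry.Lorentzian

/-- **First lemma (in print: Tataru–Robbiano–Zuily–Hörmander, specialised).** Two commuting Killing
fields with a timelike combination at `x₀` ⇒ unique continuation for `□_g u = 0` across any non-null
hypersurface `{f = f x₀}` through `x₀` (gradient `n`, `g(n,n) ≠ 0`), for arbitrary smooth `u`. -/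
def TwoKillingNonNullContinuation : Prop :=
  ∀ (𝓑 : StationaryAFBlackHole.{0}) [𝓑.metric.HasLeviCivita],
  ∀ (W : Set 𝓑.carrier) (Z : Π x : 𝓑.carrier, TangentSpace (𝓡 4) x),
    IsOpen W → W ⊆ 𝓑.doc →
    ContMDiffOn (𝓡 4) ((𝓡 4).prod 𝓘(ℝ, E4)) ((⊤ : ℕ∞) : WithTop ℕ∞)
      (fun x ↦ (Bundle.TotalSpace.mk' E4 x (Z x) : TangentBundle (𝓡 4) 𝓑.carrier)) W →
    (∀ x ∈ W, ∀ v w : TangentSpace (𝓡 4) x,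
      𝓑.metric.val x (𝓑.metric.leviCivita Z x v) w + 𝓑.metric.val x v (𝓑.metric.leviCivita Z x w) = 0) →
    (∀ x ∈ W, VectorField.mlieBracket (𝓡 4) 𝓑.killing Z x = 0) →
    ∀ x₀ ∈ W,
    (∃ c : ℝ, 𝓑.metric.val x₀ (𝓑.killing x₀ + c • Z x₀) (𝓑.killing x₀ + c • Z x₀) < 0) →
    ∀ (f u : 𝓑.carrier → ℝ) (n : TangentSpace (𝓡 4) x₀),
      ContMDiffOn (𝓡 4) 𝓘(ℝ, ℝ) ((⊤ : ℕ∞) : WithTop ℕ∞) f W →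
      ContMDiffOn (𝓡 4) 𝓘(ℝ, ℝ) ((⊤ : ℕ∞) : WithTop ℕ∞) u W →
      (∀ w : TangentSpace (𝓡 4) x₀, mfderiv (𝓡 4) 𝓘(ℝ, ℝ) f x₀ w = 𝓑.metric.val x₀ n w) →
      𝓑.metric.val x₀ n n ≠ 0 →
      (∀ x ∈ W, 𝓑.metric.dalembertian u x = 0) →
      (∀ x ∈ W, f x < f x₀ → u x = 0) →
      ∃ V : Set 𝓑.carrier, IsOpen V ∧ x₀ ∈ V ∧ ∀ x ∈ V, u x = 0

/-- **Linear rung ("no linear hair around an axisymmetric background, trapping or not").** With a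
second Killing field `Z` on the whole d.o.c. commuting with `T`, a timelike Killing combination at every
point of the d.o.c., and a `(T, Z)`-invariant height `f` without critical points on the d.o.c., every smooth
solution of `□_g u = 0` on the d.o.c. that vanishes off the `T`-orbit of a compact `S ⊆ doc` vanishes on the
d.o.c.  (No non-trapping, no analyticity, no convexity hypothesis.) -/
def NoEternalCompactWavesWithTwoKillingFields : Prop :=
  ∀ (𝓑 : StationaryAFBlackHole.{0}) [𝓑.metric.HasLeviCivita],
  ∀ (Z : Π x : 𝓑.carrier, TangentSpace (𝓡 4) x),
    ContMDiffOn (𝓡 4) ((𝓡 4).prod 𝓘(ℝ, E4)) ((⊤ : ℕ∞) : WithTop ℕ∞)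
      (fun x ↦ (Bundle.TotalSpace.mk' E4 x (Z x) : TangentBundle (𝓡 4) 𝓑.carrier)) 𝓑.doc →
    (∀ x ∈ 𝓑.doc, ∀ v w : TangentSpace (𝓡 4) x,
      𝓑.metric.val x (𝓑.metric.leviCivita Z x v) w + 𝓑.metric.val x v (𝓑.metric.leviCivita Z x w) = 0) →
    (∀ x ∈ 𝓑.doc, VectorField.mlieBracket (𝓡 4) 𝓑.killing Z x = 0) →
    (∀ x ∈ 𝓑.doc, ∃ c : ℝ, 𝓑.metric.val x (𝓑.killing x + c • Z x) (𝓑.killing x + c • Z x) < 0) →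
    ∀ (f : 𝓑.carrier → ℝ),
      ContMDiffOn (𝓡 4) 𝓘(ℝ, ℝ) ((⊤ : ℕ∞) : WithTop ℕ∞) f 𝓑.doc →
      (∀ x ∈ 𝓑.doc, mfderiv (𝓡 4) 𝓘(ℝ, ℝ) f x (𝓑.killing x) = 0) →
      (∀ x ∈ 𝓑.doc, mfderiv (𝓡 4) 𝓘(ℝ, ℝ) f x (Z x) = 0) →
      (∀ x ∈ 𝓑.doc, mfderiv (𝓡 4) 𝓘(ℝ, ℝ) f x ≠ 0) →
    ∀ (u : 𝓑.carrier → ℝ) (S : Set 𝓑.carrier),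
      ContMDiffOn (𝓡 4) 𝓘(ℝ, ℝ) ((⊤ : ℕ∞) : WithTop ℕ∞) u 𝓑.doc →
      (∀ x ∈ 𝓑.doc, 𝓑.metric.dalembertian u x = 0) →
      IsCompact S → S ⊆ 𝓑.doc →
      (∀ x ∈ 𝓑.doc, x ∉ stationaryOrbit 𝓑.killing S → u x = 0) →
      ∀ x ∈ 𝓑.doc, u x = 0

/-- The pointwise algebra behind the empty residual set: if `T + c Z` is timelike then every non-zero
vector `g`-orthogonal to both `T` and `Z` is spacelike (reverse Cauchy–Schwarz in a Lorentzian space). -/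
def OrthogonalOfTimelikePlaneIsSpacelike : Prop :=
  ∀ (𝓑 : StationaryAFBlackHole.{0}) (x : 𝓑.carrier) (Zx : TangentSpace (𝓡 4) x),
    (∃ c : ℝ, 𝓑.metric.val x (𝓑.killing x + c • Zx) (𝓑.killing x + c • Zx) < 0) →
    ∀ v : TangentSpace (𝓡 4) x, 𝓑.metric.val x v (𝓑.killing x) = 0 → 𝓑.metric.val x v Zx = 0 →
      v ≠ 0 → 0 < 𝓑.metric.val x v v

/-- `OrthogonalOfTimelikePlaneIsSpacelike` holds: reverse Cauchy–Schwarz, via the signature axiom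
`LorentzianMetric.pos_of_orthogonal`.  (This is the whole reason Tataru's residual set is empty.) -/
theorem orthogonalOfTimelikePlaneIsSpacelike_holds : OrthogonalOfTimelikePlaneIsSpacelike := by
  intro 𝓑 x Zx hc v hvT hvZ hv0
  obtain ⟨c, hc⟩ := hc
  have h1 : 𝓑.metric.val x (𝓑.killing x + c • Zx) v = 0 := by
    rw [𝓑.metric.symm x (𝓑.killing x + c • Zx) v]
    simp only [map_add, map_smul, smul_eq_mul, hvT, hvZ, mul_zero, add_zero]
  exact 𝓑.metric.pos_of_orthogonal x (𝓑.killing x + c • Zx) v hc h1 hv0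

end Summit.FinalStateConjecture.FinalStateConjecture.Cruxes.NonTrappingHawkingRigidity.AzimuthalPartialAnalyticity
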